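import Summits.SmoothPoincare4.SmoothPoincare4.Theses.ConvexBisection
import Summits.SmoothPoincare4.SmoothPoincare4.Theorems.AcyclicBisectionExists.Negative.Witness
import Summits.SmoothPoincare4.SmoothPoincare4.Theorems.AcyclicBisectionExists.Negative.Gluing
import Summits.SmoothPoincare4.SmoothPoincare4.Theorems.AcyclicBisectionExists.Negative.OneSided
import Summits.SmoothPoincare4.SmoothPoincare4.Theorems.AcyclicBisectionExists.Negative.Sphere
import Summits.SmoothPoincare4.SmoothPoincare4.Theorems.ConvexBisectionPlanarBisectionRigidityStubPlanarSeamTransfer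
import Literature.Geometry.Symplectic.EtnyrePlanarFilling
import HarnessLib

/-!
# Stub `stub_etnyrePlanarAcyclicOfFact` of line `seam-walk-one-sided-ball` for crux
# `ConvexBisection.PlanarBisectionRigidity` (item stmt-SmoothPoincare4-10511)

**Etnyre ⇒ Mayer–Vietoris: the halves of a planar common-contact Stein bisection of a homotopy
4-sphere are rationally acyclic in positive degrees, given Etnyre's planar-filling theorem.**
Let `M ≃ₕ S⁴` be a Hausdorff second-countable smooth 4-manifold bisected as
`M = e₁(W₁) ∪ e₂(W₂)` by two smoothly embedded compact Stein domains meeting exactly along the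
images of their boundaries, with equal pushed-forward complex tangencies on the seam, and assume
the contact boundary of `(W₁, J₁)` is planar.  ASSUMING the cite fact `EtnyrePlanarFilling`
(Etnyre 2004, Thm 4.1, Stein case, the two homological clauses: (i) `∂W ↪ W` is injective on
`H₀(·; ℚ)`, (ii) `H₂(∂W; ℚ) → H₂(W; ℚ)` vanishes, for every compact Stein domain with planar
contact boundary), we prove `Hₖ(W₁; ℚ) = Hₖ(W₂; ℚ) = 0` for all `k > 0`.

Proof (all engines are landed tree theorems of the package
`Theorems/AcyclicBisectionExists/Negative/`; the data is packed as a `Negative.Witness M`):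
* planarity passes to `J₂` (`…ColouredStringLinksSquareFreeAc.stub_planarSeamTransfer`);
* clause (ii) on both halves and `H₂(M) = H₃(M) = 0` give `H₂(W₁) = H₂(W₂) = H₂(∂W₁) = 0` over
  `ℚ` (pair sequences, naturality of `j_*`, the excision isomorphisms `Witness.isIso_relMap₂`;
  §1, the glue of the wave-1 scratch file `stub_nonSimplyConnectedHalves.lean`, copied);
* Lefschetz duality on the Stein halves (`Witness.exists_lefschetz₂`) and the field universal
  coefficient theorem turn `H₂(Wᵢ) = 0` into `H₂(Wᵢ, ∂Wᵢ) = 0`; then `H₁(W₂) = 0`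
  (`H₂(W₁, ∂W₁) ≅ H₂(M, e₂W₂) → H₁(e₂W₂) → H₁(M) = 0`), symmetrically `H₁(W₁) = 0`, and
  `H₁(∂W₁) = 0` (`H₂(W₁, ∂W₁) → H₁(∂W₁) → H₁(W₁)`) — §2; this replaces Poincaré duality on the seam;
* clause (i) on `W₂` with `H₁(W₂) = 0` kills `H₁(W₂, ∂W₂) ≅ H₁(M, e₁W₁)`, so
  `H₀(e₁W₁) → H₀(M) ≅ ℚ` is injective and `W₁` is connected (`H₀` detects components,
  `preconnectedSpace_of_pointClass_eq`); symmetrically `W₂` — §3;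
* `Witness.acyclic_iff_connected_and_seam` (Mayer–Vietoris ladder over `M ≃ₕ S⁴`) concludes — §4.

The cite fact is stated inline (`[cite] [topic Geometry/Symplectic]`) for relocation to
`Literature/Geometry/Symplectic/`; the stub is closed MODULO it (it is the registered neighbour
stub `stub_etnyreFact`, taken here as the explicit hypothesis `hEt`).
-/

noncomputable section

-- the prescribed namespace `Summit.<P>.<Sub>.…` duplicates `SmoothPoincare4` (P = Sub = SmoothPoincare4)
set_option linter.dupNamespace false

open scoped Manifold ContDiff Topology ContinuousMap
open Set Function
open Literature.Geometry.Symplectic Literature.AlgebraicTopology.SingularHomology CategoryTheory.Limits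

namespace Summit.SmoothPoincare4.SmoothPoincare4.Theorems.PlanarBisectionRigidity.SeamWalkOneSidedBall

/-- Local notation (as in the line's skeleton): the model space `ℝ⁴`. -/
local notation "E4" => EuclideanSpace ℝ (Fin 4)

/-- Local notation (as in the line's skeleton): the round 4-sphere. -/
local notation "𝕊⁴" => (Metric.sphere (0 : EuclideanSpace ℝ (Fin 5)) 1)

-- The cite fact `EtnyrePlanarFilling` (Etnyre 2004 Thm 4.1, clauses (i)+(ii)) now lives in
-- `Literature/Geometry/Symplectic/EtnyrePlanarFilling.lean` (relocated by the gate, p83019); it is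
-- referenced below by its short name through `open Literature.Geometry.Symplectic`.

namespace Glue

open CategoryTheory
open Summit.SmoothPoincare4.SmoothPoincare4.Theorems.AcyclicBisectionExists.Negative

variable {M : Type} [TopologicalSpace M] [ChartedSpace E4 M] (B : Witness M)

/-! ## §1 Clause (ii) on both halves ⇒ `H₂(W₁) = H₂(W₂) = H₂(∂W₁) = 0` over `ℚ`
(copied from the wave-1 scratch file `work/stubs/stub_nonSimplyConnectedHalves.lean`, §4) -/

/-- In a witness over an `M` with `H₂(M; ℚ) = 0`, `j_* : H₂(W₁; ℚ) → H₂(W₁, ∂W₁; ℚ)` vanishes: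
followed by the excision iso `H₂(W₁, ∂W₁) ≅ H₂(M, e₂W₂)` (`Witness.isIso_relMap₂` of the swapped
witness) it is `H₂(W₁) → H₂(M) → H₂(M, e₂W₂)` (naturality `ofAbsolute_comp_map`), which factors
through `H₂(M) = 0`. [folklore] -/
theorem ofAbsolute₁_eq_zero [T2Space M] [SecondCountableTopology M] [IsManifold (𝓡 4) ∞ M]
    [Nonempty M] (hM : IsZero (singularHomology ℚ ℚ M 2)) :
    relativeSingularHomology.ofAbsolute ℚ ℚ B.W₁ ((𝓡∂ 4).boundary B.W₁) 2 = 0 := by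
  haveI := B.swap.isIso_relMap₂ ℚ ℚ 2
  -- naturality of `j_*`, with `H₂(e₁) : H₂(W₁) → H₂(M) = 0` substituted
  have nat := relativeSingularHomology.ofAbsolute_comp_map (R := ℚ) (M := ℚ) B.swap.e₂CM
    B.swap.mapsTo_e₂_boundary 2
  rw [hM.eq_of_tgt (singularHomology.map ℚ ℚ B.swap.e₂CM 2) 0, Limits.zero_comp] at nat
  -- cancel the excision isomorphism
  have key : relativeSingularHomology.ofAbsolute ℚ ℚ B.swap.W₂ ((𝓡∂ 4).boundary B.swap.W₂) 2 = 0 := by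
    rw [← cancel_mono (relativeSingularHomology.map ℚ ℚ B.swap.e₂CM B.swap.mapsTo_e₂_boundary 2),
      nat, Limits.zero_comp]
  exact key

/-- Hence `H₂(∂W₁; ℚ) → H₂(W₁; ℚ)` is onto when `H₂(M; ℚ) = 0` (pair sequence). [folklore] -/
theorem epi_map_bd₁_two [T2Space M] [SecondCountableTopology M] [IsManifold (𝓡 4) ∞ M]
    [Nonempty M] (hM : IsZero (singularHomology ℚ ℚ M 2)) :
    Epi (singularHomology.map ℚ ℚ (⟨Subtype.val, continuous_subtype_val⟩ : C(B.Bd₁, B.W₁)) 2) :=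
  (relativeSingularHomology.exact_map_ofAbsolute ℚ ℚ ((𝓡∂ 4).boundary B.W₁) 2).epi_f
    (ofAbsolute₁_eq_zero B hM)

/-- **Glue for Etnyre's clause `b₂⁰ = 0`**: if `H₂(∂W₁; ℚ) → H₂(W₁; ℚ)` is zero and
`H₂(M; ℚ) = 0` then `H₂(W₁; ℚ) = 0` (onto and zero). [folklore] -/
theorem isZero_homology₁_two [T2Space M] [SecondCountableTopology M] [IsManifold (𝓡 4) ∞ M]
    [Nonempty M] (hM : IsZero (singularHomology ℚ ℚ M 2))
    (hE : singularHomology.map ℚ ℚ (⟨Subtype.val, continuous_subtype_val⟩ : C(B.Bd₁, B.W₁)) 2 = 0) :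
    IsZero (singularHomology ℚ ℚ B.W₁ 2) := by
  haveI := epi_map_bd₁_two B hM
  exact Limits.IsZero.of_epi_eq_zero _ hE

/-- `H₃(W₁, ∂W₁; ℚ) = 0` as soon as `H₃(M; ℚ) = 0` and `H₂(W₂; ℚ) = 0`:
`H₃(W₁, ∂W₁) ≅ H₃(M, e₂W₂)` sits in the exact `H₃(M) → H₃(M, e₂W₂) → H₂(e₂W₂)`. [folklore] -/
theorem isZero_relHomology₁_three [T2Space M] [SecondCountableTopology M] [IsManifold (𝓡 4) ∞ M]
    [Nonempty M] (hM3 : IsZero (singularHomology ℚ ℚ M 3))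
    (h₂ : IsZero (singularHomology ℚ ℚ B.W₂ 2)) :
    IsZero (relativeSingularHomology ℚ ℚ B.W₁ ((𝓡∂ 4).boundary B.W₁) 3) := by
  haveI := B.swap.isIso_relMap₂ ℚ ℚ 3
  have hr : IsZero (singularHomology ℚ ℚ ↥(range B.e₂) 2) :=
    h₂.of_iso (singularHomology.mapIso ℚ ℚ B.emb₂.isEmbedding.toHomeomorph 2).symm
  have hrel : IsZero (relativeSingularHomology ℚ ℚ M (range B.e₂) 3) :=
    (relativeSingularHomology.exact_ofAbsolute_δ ℚ ℚ (range B.e₂) 2).isZero_of_both_zeros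
      (hM3.eq_of_src _ _) (hr.eq_of_tgt _ _)
  -- the excision iso at its own (swapped) type, compared up to definitional unfolding
  have eiso := asIso (relativeSingularHomology.map ℚ ℚ B.swap.e₂CM B.swap.mapsTo_e₂_boundary 3)
  exact hrel.of_iso eiso

/-- `H₂(∂W₁; ℚ) = 0` from `H₃(W₁, ∂W₁; ℚ) = 0` and `H₂(W₁; ℚ) = 0` (pair sequence). [folklore] -/
theorem isZero_homology_bd₁_two [T2Space M] [SecondCountableTopology M] [IsManifold (𝓡 4) ∞ M]
    [Nonempty M] (hM3 : IsZero (singularHomology ℚ ℚ M 3))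
    (h₁ : IsZero (singularHomology ℚ ℚ B.W₁ 2)) (h₂ : IsZero (singularHomology ℚ ℚ B.W₂ 2)) :
    IsZero (singularHomology ℚ ℚ B.Bd₁ 2) :=
  (relativeSingularHomology.exact_δ_map ℚ ℚ ((𝓡∂ 4).boundary B.W₁) 2).isZero_of_both_zeros
    ((isZero_relHomology₁_three B hM3 h₂).eq_of_src _ _) (h₁.eq_of_tgt _ _)

/-! ## §2 Lefschetz duality on the Stein halves ⇒ `H₁(W₁) = H₁(W₂) = H₁(∂W₁) = 0` over `ℚ` -/

/-- **Lefschetz vanishing, one degree at a time**: if `Hₚ(W₂; ℚ) = 0` then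
`H_q(W₂, ∂W₂; ℚ) = 0` for `p + q = 4` — Lefschetz duality `Hᵖ(W₂; ℚ) ≅ H_q(W₂, ∂W₂; ℚ)` on the
ℚ-oriented Stein half (`Witness.exists_lefschetz₂`) and `Hᵖ(W₂; ℚ) = 0` by the field universal
coefficient theorem (`kroneckerPairing_injective_of_field`).  (The landed
`Witness.isZero_relHomology₂` asks for acyclicity in all positive degrees; its proof uses only
degree `p`, repeated here.) [folklore] -/
theorem isZero_relHomology₂_of_isZero [T2Space M] [SecondCountableTopology M] [Nonempty M]
    {p q : ℕ} (hp : IsZero (singularHomology ℚ ℚ B.W₂ p)) (h : p + q = 2 + 1 + 1) :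
    IsZero (relativeSingularHomology ℚ ℚ B.W₂ ((𝓡∂ (2 + 1 + 1)).boundary B.W₂) q) := by
  haveI := B.t2Space₂
  obtain ⟨zq, hbij⟩ := B.exists_lefschetz₂ h
  haveI : Subsingleton (singularHomology ℚ ℚ B.W₂ p) := ModuleCat.subsingleton_of_isZero hp
  have hsub : Subsingleton (singularCohomology ℚ ℚ B.W₂ p) :=
    ⟨fun a b => kroneckerPairing_injective_of_field ℚ B.W₂ p
      (LinearMap.ext fun c => by rw [Subsingleton.elim c 0, map_zero, map_zero])⟩
  haveI : Subsingleton (relativeSingularHomology ℚ ℚ B.W₂ ((𝓡∂ (2 + 1 + 1)).boundary B.W₂) q) :=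
    ⟨fun x y => by
      obtain ⟨a, rfl⟩ := hbij.2 x
      obtain ⟨b, rfl⟩ := hbij.2 y
      rw [Subsingleton.elim a b]⟩
  exact ModuleCat.isZero_of_subsingleton _

/-- **`H₁(W₂; ℚ) = 0` from `H₂(W₁; ℚ) = 0` and `H₁(M; ℚ) = 0`**:
`H₂(W₁, ∂W₁) = 0` (Lefschetz, `H₂(W₁) = 0`) and `H₂(W₁, ∂W₁) ≅ H₂(M, e₂W₂) → H₁(e₂W₂) → H₁(M) = 0`
is exact. [folklore] -/
theorem isZero_homology₂_one [T2Space M] [SecondCountableTopology M] [IsManifold (𝓡 4) ∞ M]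
    [Nonempty M] (hM1 : IsZero (singularHomology ℚ ℚ M 1))
    (h2₁ : IsZero (singularHomology ℚ ℚ B.W₁ 2)) : IsZero (singularHomology ℚ ℚ B.W₂ 1) := by
  refine IsZero.of_iso ?_ (singularHomology.mapIso ℚ ℚ B.emb₂.isEmbedding.toHomeomorph 1)
  -- `H₂(W₁, ∂W₁) = 0` by Lefschetz on the swapped witness
  have hrel₁ := isZero_relHomology₂_of_isZero B.swap (p := 2) (q := 2) h2₁ rfl
  -- `≅ H₂(M, e₂W₂)`
  haveI := B.swap.isIso_relMap₂ ℚ ℚ 2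
  have hrel : IsZero (relativeSingularHomology ℚ ℚ M (range B.e₂) 2) :=
    hrel₁.of_iso (asIso (relativeSingularHomology.map ℚ ℚ B.swap.e₂CM
      B.swap.mapsTo_e₂_boundary 2)).symm
  exact (relativeSingularHomology.exact_δ_map ℚ ℚ (range B.e₂) 1).isZero_of_both_zeros
    (hrel.eq_of_src _ _) (hM1.eq_of_tgt _ _)

/-- **`H₁(∂W₁; ℚ) = 0` from `H₂(W₁; ℚ) = H₁(W₁; ℚ) = 0`**: the exact
`H₂(W₁, ∂W₁) → H₁(∂W₁) → H₁(W₁)` with `H₂(W₁, ∂W₁) = 0` by Lefschetz.  This replaces Poincaré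
duality `b₁ = b₂` on the closed oriented seam. [folklore] -/
theorem isZero_homology_bd₁_one [T2Space M] [SecondCountableTopology M] [Nonempty M]
    (h2₁ : IsZero (singularHomology ℚ ℚ B.W₁ 2)) (h1₁ : IsZero (singularHomology ℚ ℚ B.W₁ 1)) :
    IsZero (singularHomology ℚ ℚ B.Bd₁ 1) := by
  have hrel₁ := isZero_relHomology₂_of_isZero B.swap (p := 2) (q := 2) h2₁ rfl
  exact (relativeSingularHomology.exact_δ_map ℚ ℚ ((𝓡∂ 4).boundary B.W₁) 1).isZero_of_both_zeros
    (hrel₁.eq_of_src _ _) (h1₁.eq_of_tgt _ _)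

/-! ## §3 Clause (i) ⇒ connected halves -/

/-- **`W₁` is connected** as soon as `M` is path connected, `H₁(W₂; ℚ) = 0` and `∂W₂ ↪ W₂` is
injective on `H₀(·; ℚ)` (Etnyre's clause (i) for `W₂`): the exact
`H₁(W₂) = 0 → H₁(W₂, ∂W₂) → H₀(∂W₂) ↪ H₀(W₂)` kills `H₁(W₂, ∂W₂) ≅ H₁(M, e₁W₁)`, so
`H₀(e₁W₁) → H₀(M) ≅ ℚ` is injective, all point classes of `e₁W₁ ≃ₜ W₁` agree, and `H₀` detects
components (`preconnectedSpace_of_pointClass_eq`).  Same skeleton as the landed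
`Witness.connectedSpace₁_of_acyclic`, with Lefschetz vanishing replaced by clause (i). [folklore] -/
theorem connectedSpace₁_of_injective [T2Space M] [SecondCountableTopology M] [IsManifold (𝓡 4) ∞ M]
    [Nonempty M] [PathConnectedSpace M]
    (hinj₂ : Function.Injective (singularHomology.map ℚ ℚ
      (⟨Subtype.val, continuous_subtype_val⟩ : C(B.Bd₂, B.W₂)) 0))
    (h1₂ : IsZero (singularHomology ℚ ℚ B.W₂ 1)) : ConnectedSpace B.W₁ := by
  haveI := B.t2Space₁
  haveI : Nonempty B.W₁ := B.halves_nonempty.1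
  -- `H₁(W₂, ∂W₂) = 0`
  haveI : Mono (singularHomology.map ℚ ℚ
      (⟨Subtype.val, continuous_subtype_val⟩ : C(B.Bd₂, B.W₂)) 0) :=
    (ModuleCat.mono_iff_injective _).mpr hinj₂
  have hδ : relativeSingularHomology.δ ℚ ℚ B.W₂ ((𝓡∂ 4).boundary B.W₂) 0 = 0 :=
    Limits.zero_of_comp_mono _ (relativeSingularHomology.δ_comp_map ℚ ℚ ((𝓡∂ 4).boundary B.W₂) 0)
  have hrel₂ : IsZero (relativeSingularHomology ℚ ℚ B.W₂ ((𝓡∂ 4).boundary B.W₂) 1) :=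
    (relativeSingularHomology.exact_ofAbsolute_δ ℚ ℚ ((𝓡∂ 4).boundary B.W₂) 0).isZero_of_both_zeros
      (h1₂.eq_of_src _ _) hδ
  -- `H₁(M, e₁W₁) ≅ H₁(W₂, ∂W₂) = 0`
  haveI := B.isIso_relMap₂ ℚ ℚ 1
  have hrel : IsZero (relativeSingularHomology ℚ ℚ M (range B.e₁) 1) :=
    hrel₂.of_iso (asIso (relativeSingularHomology.map ℚ ℚ B.e₂CM B.mapsTo_e₂_boundary 1)).symm
  -- `H₀(e₁W₁) → H₀(M)` injective
  have hmono : Mono (singularHomology.map ℚ ℚ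
      (⟨Subtype.val, continuous_subtype_val⟩ : C(↥(range B.e₁), M)) 0) :=
    (relativeSingularHomology.exact_δ_map ℚ ℚ (range B.e₁) 0).mono_g (hrel.eq_of_src _ _)
  have hinj := (ModuleCat.mono_iff_injective _).mp hmono
  -- hence `e₁ W₁ ≃ₜ W₁` is preconnected
  haveI : LocallyPathConnectedSpace B.W₁ :=
    ChartedSpace.locallyPathConnectedSpace (EuclideanHalfSpace 4) B.W₁
  haveI : LocallyConnectedSpace ↥(range B.e₁) :=
    B.emb₁.isEmbedding.toHomeomorph.symm.locallyConnectedSpace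
  haveI : PreconnectedSpace ↥(range B.e₁) := preconnectedSpace_of_pointClass_eq fun z z' => hinj (by
    rw [map_pointClass, map_pointClass]
    exact pointClass_eq_of_pathConnectedSpace _ _)
  haveI : PreconnectedSpace B.W₁ :=
    ⟨by simpa using B.emb₁.isEmbedding.toHomeomorph.symm.isPreconnected_image.2 isPreconnected_univ⟩
  exact ⟨‹_›⟩

/-! ## §4 Assembly: the four inputs of `Witness.acyclic_iff_connected_and_seam` -/

/-- **Etnyre's two clauses on both (planar) halves of a witness over `M ≃ₕ S⁴` give connected
halves and a seam with `H₁ = H₂ = 0` over `ℚ`.** [folklore] -/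
theorem connected_and_seam [T2Space M] [SecondCountableTopology M] [IsManifold (𝓡 4) ∞ M]
    [Nonempty M] (hEt : EtnyrePlanarFilling) (e : M ≃ₕ 𝕊⁴)
    (hpl₁ : PlanarContactBoundary B.J₁) (hpl₂ : PlanarContactBoundary B.J₂) :
    ConnectedSpace B.W₁ ∧ ConnectedSpace B.W₂ ∧
      IsZero (singularHomology ℚ ℚ B.Bd₁ 1) ∧ IsZero (singularHomology ℚ ℚ B.Bd₁ 2) := by
  haveI := B.t2Space₁
  haveI := B.t2Space₂
  haveI : T2Space B.swap.W₁ := B.t2Space₂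
  haveI : T2Space B.swap.W₂ := B.t2Space₁
  haveI : PathConnectedSpace 𝕊⁴ := Literature.Topology.FourManifolds.pathConnectedSpace_sphere_four
  haveI : PathConnectedSpace M := Literature.Topology.FourManifolds.pathConnectedSpace_of_homotopyEquiv e
  have hM1 : IsZero (singularHomology ℚ ℚ M 1) :=
    Witness.isZero_homology_of_homotopyEquiv_sphere e (by norm_num) (by norm_num)
  have hM2 : IsZero (singularHomology ℚ ℚ M 2) :=
    Witness.isZero_homology_of_homotopyEquiv_sphere e (by norm_num) (by norm_num)
  have hM3 : IsZero (singularHomology ℚ ℚ M 3) :=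
    Witness.isZero_homology_of_homotopyEquiv_sphere e (by norm_num) (by norm_num)
  -- degree 2 (clause (ii) on both halves)
  have h2₁ : IsZero (singularHomology ℚ ℚ B.W₁ 2) :=
    isZero_homology₁_two B hM2 (hEt.2 B.W₁ B.J₁ hpl₁)
  have h2₂ : IsZero (singularHomology ℚ ℚ B.W₂ 2) :=
    isZero_homology₁_two B.swap hM2 (hEt.2 B.W₂ B.J₂ hpl₂)
  have hΓ₂ : IsZero (singularHomology ℚ ℚ B.Bd₁ 2) := isZero_homology_bd₁_two B hM3 h2₁ h2₂
  -- degree 1 (Lefschetz on the halves)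
  have h1₂ : IsZero (singularHomology ℚ ℚ B.W₂ 1) := isZero_homology₂_one B hM1 h2₁
  have h1₁ : IsZero (singularHomology ℚ ℚ B.W₁ 1) := isZero_homology₂_one B.swap hM1 h2₂
  have hΓ₁ : IsZero (singularHomology ℚ ℚ B.Bd₁ 1) := isZero_homology_bd₁_one B h2₁ h1₁
  -- connectedness (clause (i) on the other half)
  have hc₁ : ConnectedSpace B.W₁ := connectedSpace₁_of_injective B (hEt.1 B.W₂ B.J₂ hpl₂) h1₂
  have hc₂ : ConnectedSpace B.W₂ :=
    connectedSpace₁_of_injective B.swap (hEt.1 B.W₁ B.J₁ hpl₁) h1₁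
  exact ⟨hc₁, hc₂, hΓ₁, hΓ₂⟩

end Glue

open Summit.SmoothPoincare4.SmoothPoincare4.Theorems.AcyclicBisectionExists in
/-- **Stub `stub_etnyrePlanarAcyclicOfFact` (registered; line `seam-walk-one-sided-ball`).**
Given Etnyre's planar-filling theorem in the form `EtnyrePlanarFilling` (clauses (i) `∂W ↪ W`
injective on `H₀(·; ℚ)` and (ii) `H₂(∂W; ℚ) → H₂(W; ℚ)` zero, for compact Stein domains with
planar contact boundary): for a Hausdorff second-countable smooth `M ≃ₕ S⁴` bisected as
`M = e₁(W₁) ∪ e₂(W₂)` by two smoothly embedded compact Stein domains meeting exactly along the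
images of their boundaries, with equal pushed-forward complex tangencies on the seam and with
`(∂W₁, ξ_{J₁})` planar, both halves are ℚ-acyclic in positive degrees:
`Hₖ(W₁; ℚ) = Hₖ(W₂; ℚ) = 0` for all `k > 0`.  Proof: pack the data as a `Negative.Witness M`;
planarity of `J₂` by the landed `stub_planarSeamTransfer`; `Glue.connected_and_seam` (clause (ii)
+ pair sequences + excision ⇒ `b₂ = 0`; Lefschetz on the halves ⇒ `b₁ = 0` and `b₁(∂W₁) = 0`;
clause (i) ⇒ connected halves); conclude by the landed Mayer–Vietoris ladder
`Witness.acyclic_iff_connected_and_seam`. [folklore] -/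
theorem stub_etnyrePlanarAcyclicOfFact (hEt : EtnyrePlanarFilling)
    (M : Type) [TopologicalSpace M] [T2Space M] [SecondCountableTopology M] [ChartedSpace E4 M]
    [IsManifold (𝓡 4) ∞ M] (hM : M ≃ₕ 𝕊⁴)
    (W₁ : Type) [TopologicalSpace W₁] [ChartedSpace (EuclideanHalfSpace 4) W₁] [IsManifold (𝓡∂ 4) ∞ W₁]
    [CompactSpace W₁] (W₂ : Type) [TopologicalSpace W₂] [ChartedSpace (EuclideanHalfSpace 4) W₂]
    [IsManifold (𝓡∂ 4) ∞ W₂] [CompactSpace W₂] (J₁ : SteinStructure W₁) (J₂ : SteinStructure W₂)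
    (e₁ : W₁ → M) (e₂ : W₂ → M)
    (he₁ : Manifold.IsSmoothEmbedding (𝓡∂ 4) (𝓡 4) ∞ e₁)
    (he₂ : Manifold.IsSmoothEmbedding (𝓡∂ 4) (𝓡 4) ∞ e₂)
    (hcover : range e₁ ∪ range e₂ = univ)
    (hseam₁ : range e₁ ∩ range e₂ = e₁ '' (𝓡∂ 4).boundary W₁)
    (hseam₂ : range e₁ ∩ range e₂ = e₂ '' (𝓡∂ 4).boundary W₂)
    (hξ : ∀ w₁ w₂, e₁ w₁ = e₂ w₂ →
      Submodule.map (mfderiv (𝓡∂ 4) (𝓡 4) e₁ w₁).toLinearMap (contactPlane J₁.J w₁) =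
      Submodule.map (mfderiv (𝓡∂ 4) (𝓡 4) e₂ w₂).toLinearMap (contactPlane J₂.J w₂))
    (hplanar : PlanarContactBoundary J₁) :
    ∀ k, 0 < k → IsZero (singularHomology ℚ ℚ W₁ k) ∧ IsZero (singularHomology ℚ ℚ W₂ k) := by
  haveI : Nonempty M := ⟨hM.invFun ⟨EuclideanSpace.single 0 1, by simp⟩⟩
  -- planarity crosses the seam (landed `stub_planarSeamTransfer`)
  have hpl₂ : PlanarContactBoundary J₂ :=
    ColouredStringLinksSquareFreeAc.stub_planarSeamTransfer M W₁ W₂ J₁ J₂ e₁ e₂ he₁ he₂ hcover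
      hseam₁ hseam₂ hξ hplanar
  -- the crux data as a witness of the sibling package
  let B : Negative.Witness M := ⟨W₁, W₂, J₁, J₂, e₁, e₂, he₁, he₂, hcover, hseam₁, hseam₂, hξ⟩
  exact (B.acyclic_iff_connected_and_seam hM).2 (Glue.connected_and_seam B hEt hM hplanar hpl₂)

end Summit.SmoothPoincare4.SmoothPoincare4.Theorems.PlanarBisectionRigidity.SeamWalkOneSidedBall

end
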